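import Summits.AtomisticToContinuum.Crystallization.Theorems.HullExactificationCascadeExactHcpLocalTheoremBond

/-!
# Route HullExactificationCascade — item `ExactHcpLocalTheorem` (G), helper 6: propagation steps

Helper file 6 for `stmt-AtomisticToContinuum-12093`.  For a point set `S ⊆ ℝ³` with the exact local
rule (every `y ∈ S` has `S ∩ B(y, 13/10 a) = y + A_y '' N` for a linear isometry `A_y`): transport
of cluster identities and of the rule under linear isometries; the **in-layer step**
(`S ∩ B(z) = z + N ⟹ S ∩ B(z + u) = z + u + N`, and its conjugates along `g u` for clusters `g '' N`);
the **interlayer step** (`z + N, z + u + N, z + v + N ⊆ S ⟹ S ∩ B(z + w + h e₃) = z + w + h e₃ +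
halfTurn '' N`, and conjugates). [folklore]
-/

noncomputable section

namespace Summit.AtomisticToContinuum.Crystallization.Theorems.ExactHcpLocal

open Literature.MathematicalPhysics.StatisticalMechanics

variable {a h : ℝ}

/-! ## Propagation file: clusters of a point set with hcp local rules, layer by layer -/

section Propagation

open RealInnerProductSpace Literature.Geometry.DiscreteGeometry

/-! ### Transport of clusters and of the local rule under isometries -/

/-- Membership in a translate. [folklore] -/
theorem mem_translate_iff {M : Set (EuclideanSpace ℝ (Fin 3))} {z x : EuclideanSpace ℝ (Fin 3)} :
    x ∈ (fun m => z + m) '' M ↔ x - z ∈ M := by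
  constructor
  · rintro ⟨m, hm, rfl⟩; simpa using hm
  · intro hx; exact ⟨x - z, hx, by abel⟩

/-- **Transport of a cluster identity by a linear isometry.** [folklore] -/
theorem cluster_transport (g : EuclideanSpace ℝ (Fin 3) ≃ₗᵢ[ℝ] EuclideanSpace ℝ (Fin 3))
    {S M : Set (EuclideanSpace ℝ (Fin 3))} {z : EuclideanSpace ℝ (Fin 3)} {r : ℝ}
    (hcl : S ∩ Metric.ball z r = (fun m => z + m) '' M) :
    (g '' S) ∩ Metric.ball (g z) r = (fun m => g z + m) '' (g '' M) := by
  ext x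
  rw [mem_translate_iff, mem_image_equiv_iff, Set.mem_inter_iff, mem_image_equiv_iff,
    Metric.mem_ball]
  have key : g.symm x ∈ S ∩ Metric.ball z r ↔ g.symm x - z ∈ M := by
    rw [hcl, mem_translate_iff]
  rw [Set.mem_inter_iff, Metric.mem_ball] at key
  have hd : dist (g.symm x) z = dist x (g z) := by
    rw [← g.dist_map (g.symm x) z, g.apply_symm_apply]
  rw [hd] at key
  rw [key, map_sub, g.symm_apply_apply]

/-- **Transport of the local rule by a linear isometry**: if every point of `S` has cluster
`y + A_y '' N`, so does every point of `g '' S` (with `A_y` followed by `g`). [folklore] -/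
theorem localRule_transport (g : EuclideanSpace ℝ (Fin 3) ≃ₗᵢ[ℝ] EuclideanSpace ℝ (Fin 3))
    {S N : Set (EuclideanSpace ℝ (Fin 3))} {r : ℝ}
    (hS : ∀ y ∈ S, ∃ A : EuclideanSpace ℝ (Fin 3) ≃ₗᵢ[ℝ] EuclideanSpace ℝ (Fin 3),
      S ∩ Metric.ball y r = (fun n => y + A n) '' N) :
    ∀ y ∈ g '' S, ∃ A : EuclideanSpace ℝ (Fin 3) ≃ₗᵢ[ℝ] EuclideanSpace ℝ (Fin 3),
      (g '' S) ∩ Metric.ball y r = (fun n => y + A n) '' N := by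
  rintro _ ⟨y, hy, rfl⟩
  obtain ⟨A, hA⟩ := hS y hy
  refine ⟨A.trans g, ?_⟩
  have hA' : S ∩ Metric.ball y r = (fun m => y + m) '' (A '' N) := by
    rw [hA, Set.image_image]
  rw [cluster_transport g hA', Set.image_image, Set.image_image]
  rfl

/-- Transport of an inclusion of a translate. [folklore] -/
theorem translate_subset_transport (g : EuclideanSpace ℝ (Fin 3) ≃ₗᵢ[ℝ] EuclideanSpace ℝ (Fin 3))
    {S M : Set (EuclideanSpace ℝ (Fin 3))} {z : EuclideanSpace ℝ (Fin 3)}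
    (hsub : (fun m => z + m) '' M ⊆ S) : (fun m => g z + m) '' (g '' M) ⊆ g '' S := by
  rintro _ ⟨_, ⟨m, hm, rfl⟩, rfl⟩
  refine ⟨z + m, hsub ⟨m, hm, rfl⟩, by simp⟩

/-! ### The in-layer step -/

/-- **In-layer step along `u`.** If every point of `S` has an hcp cluster (up to a linear
isometry) and the cluster of `S` at `z` is exactly `z + N`, then the cluster at `z + u` is
exactly `z + u + N` (`image_cluster_eq_of_bond`). [folklore] -/
theorem inLayer_step (ha : 0 < a) (hh : 0 < h) (hh1 : 64 / 100 * a ^ 2 < h ^ 2)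
    (hh2 : h ^ 2 < 69 / 100 * a ^ 2) {S : Set (EuclideanSpace ℝ (Fin 3))}
    (hS : ∀ y ∈ S, ∃ A : EuclideanSpace ℝ (Fin 3) ≃ₗᵢ[ℝ] EuclideanSpace ℝ (Fin 3),
      S ∩ Metric.ball y (13 / 10 * a) = (fun n => y + A n) ''
        {p : EuclideanSpace ℝ (Fin 3) | p ∈ hcpStacking a h ∧ ‖p‖ < 13 / 10 * a})
    {z : EuclideanSpace ℝ (Fin 3)}
    (hz : S ∩ Metric.ball z (13 / 10 * a) = (fun n => z + n) ''
        {p : EuclideanSpace ℝ (Fin 3) | p ∈ hcpStacking a h ∧ ‖p‖ < 13 / 10 * a}) :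
    S ∩ Metric.ball (z + barlowPos a h alternatingHagg 0 1 0) (13 / 10 * a) =
      (fun n => z + barlowPos a h alternatingHagg 0 1 0 + n) ''
        {p : EuclideanSpace ℝ (Fin 3) | p ∈ hcpStacking a h ∧ ‖p‖ < 13 / 10 * a} := by
  set N := {p : EuclideanSpace ℝ (Fin 3) | p ∈ hcpStacking a h ∧ ‖p‖ < 13 / 10 * a} with hN
  set u := barlowPos a h alternatingHagg 0 1 0 with hudef
  have huN : u ∈ N := site_mem_cluster ha hh1 hh2 (by omega)
  have hzu : z + u ∈ S := by
    have : z + u ∈ S ∩ Metric.ball z (13 / 10 * a) := by rw [hz]; exact ⟨u, huN, rfl⟩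
    exact this.1
  obtain ⟨A, hA⟩ := hS _ hzu
  have hK : ∀ x : EuclideanSpace ℝ (Fin 3), (x ∈ A '' N ∧ ‖u + x‖ < 13 / 10 * a) ↔
      (u + x ∈ N ∧ ‖x‖ < 13 / 10 * a) := by
    intro x
    have e1 : x ∈ A '' N ↔ z + u + x ∈ S ∧ ‖x‖ < 13 / 10 * a := by
      have : x ∈ A '' N ↔ z + u + x ∈ S ∩ Metric.ball (z + u) (13 / 10 * a) := by
        rw [hA]
        constructor
        · rintro ⟨n, hn, rfl⟩; exact ⟨n, hn, rfl⟩
        · rintro ⟨n, hn, he⟩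
          have : A n = x := add_left_cancel he
          exact ⟨n, hn, this⟩
      rw [this, Set.mem_inter_iff, Metric.mem_ball, dist_eq_norm, add_sub_cancel_left]
    have e2 : u + x ∈ N ↔ z + u + x ∈ S ∧ ‖u + x‖ < 13 / 10 * a := by
      have : u + x ∈ N ↔ z + (u + x) ∈ S ∩ Metric.ball z (13 / 10 * a) := by
        rw [hz, mem_translate_iff, add_sub_cancel_left]
      rw [this, Set.mem_inter_iff, Metric.mem_ball, dist_eq_norm, add_sub_cancel_left, add_assoc]
    rw [e1, e2]
    tauto
  have himg : A '' N = N := image_cluster_eq_of_bond ha hh hh1 hh2 A hK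
  calc S ∩ Metric.ball (z + u) (13 / 10 * a) = (fun n => z + u + A n) '' N := hA
    _ = (fun n => z + u + n) '' (A '' N) := by rw [Set.image_image]
    _ = (fun n => z + u + n) '' N := by rw [himg]

/-- **In-layer step along `g u`, for clusters of type `g '' N`** (`g` a linear isometry):
conjugate `inLayer_step` by `g`. [folklore] -/
theorem inLayer_step_conj (ha : 0 < a) (hh : 0 < h) (hh1 : 64 / 100 * a ^ 2 < h ^ 2)
    (hh2 : h ^ 2 < 69 / 100 * a ^ 2) (g : EuclideanSpace ℝ (Fin 3) ≃ₗᵢ[ℝ] EuclideanSpace ℝ (Fin 3))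
    {S : Set (EuclideanSpace ℝ (Fin 3))}
    (hS : ∀ y ∈ S, ∃ A : EuclideanSpace ℝ (Fin 3) ≃ₗᵢ[ℝ] EuclideanSpace ℝ (Fin 3),
      S ∩ Metric.ball y (13 / 10 * a) = (fun n => y + A n) ''
        {p : EuclideanSpace ℝ (Fin 3) | p ∈ hcpStacking a h ∧ ‖p‖ < 13 / 10 * a})
    {z : EuclideanSpace ℝ (Fin 3)}
    (hz : S ∩ Metric.ball z (13 / 10 * a) = (fun n => z + n) ''
        (g '' {p : EuclideanSpace ℝ (Fin 3) | p ∈ hcpStacking a h ∧ ‖p‖ < 13 / 10 * a})) :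
    S ∩ Metric.ball (z + g (barlowPos a h alternatingHagg 0 1 0)) (13 / 10 * a) =
      (fun n => z + g (barlowPos a h alternatingHagg 0 1 0) + n) ''
        (g '' {p : EuclideanSpace ℝ (Fin 3) | p ∈ hcpStacking a h ∧ ‖p‖ < 13 / 10 * a}) := by
  set N := {p : EuclideanSpace ℝ (Fin 3) | p ∈ hcpStacking a h ∧ ‖p‖ < 13 / 10 * a} with hN
  set S' := g.symm '' S with hS'
  have hS'S : g '' S' = S := by rw [hS', ← Set.image_comp]; simp
  have hgg : ∀ M : Set (EuclideanSpace ℝ (Fin 3)), g.symm '' (g '' M) = M := fun M => by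
    rw [← Set.image_comp]; simp
  have h1 : ∀ y ∈ S', ∃ A : EuclideanSpace ℝ (Fin 3) ≃ₗᵢ[ℝ] EuclideanSpace ℝ (Fin 3),
      S' ∩ Metric.ball y (13 / 10 * a) = (fun n => y + A n) '' N := localRule_transport g.symm hS
  have h2 : S' ∩ Metric.ball (g.symm z) (13 / 10 * a) = (fun n => g.symm z + n) '' N := by
    have := cluster_transport g.symm hz
    rwa [hgg] at this
  have h3 := inLayer_step ha hh hh1 hh2 h1 h2
  have h4 := cluster_transport g h3
  rw [hS'S, map_add, g.apply_symm_apply] at h4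
  exact h4

/-! ### The interlayer step -/

/-- **Interlayer step.** If every point of `S` has an hcp cluster and `S` contains the
translates `z + N`, `z + u + N`, `z + v + N` (the clusters of a triangle of a hexagon layer of
type `N`), then the cluster of `S` at the cap point `z + w + h e₃` is the twin cluster
`halfTurn '' N` (`image_cluster_eq_twin`). [folklore] -/
theorem interLayer_step (ha : 0 < a) (hh : 0 < h) (hh1 : 64 / 100 * a ^ 2 < h ^ 2)
    (hh2 : h ^ 2 < 69 / 100 * a ^ 2) {S : Set (EuclideanSpace ℝ (Fin 3))}
    (hS : ∀ y ∈ S, ∃ A : EuclideanSpace ℝ (Fin 3) ≃ₗᵢ[ℝ] EuclideanSpace ℝ (Fin 3),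
      S ∩ Metric.ball y (13 / 10 * a) = (fun n => y + A n) ''
        {p : EuclideanSpace ℝ (Fin 3) | p ∈ hcpStacking a h ∧ ‖p‖ < 13 / 10 * a})
    {z : EuclideanSpace ℝ (Fin 3)}
    (h0 : (fun n => z + n) '' {p : EuclideanSpace ℝ (Fin 3) | p ∈ hcpStacking a h ∧ ‖p‖ < 13 / 10 * a} ⊆ S)
    (hu : (fun n => z + barlowPos a h alternatingHagg 0 1 0 + n) ''
      {p : EuclideanSpace ℝ (Fin 3) | p ∈ hcpStacking a h ∧ ‖p‖ < 13 / 10 * a} ⊆ S)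
    (hv : (fun n => z + barlowPos a h alternatingHagg 0 0 1 + n) ''
      {p : EuclideanSpace ℝ (Fin 3) | p ∈ hcpStacking a h ∧ ‖p‖ < 13 / 10 * a} ⊆ S) :
    S ∩ Metric.ball (z + barlowPos a h alternatingHagg 1 0 0) (13 / 10 * a) =
      (fun n => z + barlowPos a h alternatingHagg 1 0 0 + n) ''
        (halfTurn '' {p : EuclideanSpace ℝ (Fin 3) | p ∈ hcpStacking a h ∧ ‖p‖ < 13 / 10 * a}) := by
  set N := {p : EuclideanSpace ℝ (Fin 3) | p ∈ hcpStacking a h ∧ ‖p‖ < 13 / 10 * a} with hN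
  set p := barlowPos a h alternatingHagg 1 0 0 with hpdef
  have hpN : p ∈ N := site_mem_cluster ha hh1 hh2 (by omega)
  have hzp : z + p ∈ S := h0 ⟨p, hpN, rfl⟩
  obtain ⟨A, hA⟩ := hS _ hzp
  have memA : ∀ x, x ∈ A '' N ↔ z + p + x ∈ S ∧ ‖x‖ < 13 / 10 * a := by
    intro x
    have : x ∈ A '' N ↔ z + p + x ∈ S ∩ Metric.ball (z + p) (13 / 10 * a) := by
      rw [hA]
      constructor
      · rintro ⟨n, hn, rfl⟩; exact ⟨n, hn, rfl⟩
      · rintro ⟨n, hn, he⟩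
        exact ⟨n, hn, add_left_cancel he⟩
    rw [this, Set.mem_inter_iff, Metric.mem_ball, dist_eq_norm, add_sub_cancel_left]
  -- the hexagon layer of the cluster at `z + p` comes from the three translates
  have hX : ∀ i j : ℤ, (-1 ≤ i ∧ i ≤ 1 ∧ -1 ≤ j ∧ j ≤ 1 ∧ -1 ≤ i + j ∧ i + j ≤ 1) →
      barlowPos a h alternatingHagg 0 i j ∈ A '' N := by
    intro i j hij
    rw [memA]
    refine ⟨?_, (norm_site_lt_iff ha hh1 hh2 0 i j).2 (by omega)⟩
    have e1 : p + barlowPos a h alternatingHagg 0 i j = barlowPos a h alternatingHagg 1 i j := by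
      rw [hpdef, add_comm, hcp_add_of_even a h Even.zero]; simp
    by_cases h1 : -1 ≤ i ∧ i ≤ 0 ∧ -1 ≤ j ∧ j ≤ 0 ∧ -1 ≤ i + j
    · refine h0 ⟨barlowPos a h alternatingHagg 1 i j, site_mem_cluster ha hh1 hh2 (by omega), ?_⟩
      show z + _ = z + p + _
      rw [add_assoc, e1]
    by_cases h2 : -1 ≤ i - 1 ∧ i - 1 ≤ 0 ∧ -1 ≤ j ∧ j ≤ 0 ∧ -1 ≤ i - 1 + j
    · refine hu ⟨barlowPos a h alternatingHagg 1 (i - 1) j, site_mem_cluster ha hh1 hh2 (by omega), ?_⟩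
      show z + _ + _ = z + p + _
      rw [add_assoc, add_assoc, e1, hcp_add_of_even a h Even.zero]
      congr 2 <;> ring
    have h3 : -1 ≤ i ∧ i ≤ 0 ∧ -1 ≤ j - 1 ∧ j - 1 ≤ 0 ∧ -1 ≤ i + (j - 1) := by omega
    refine hv ⟨barlowPos a h alternatingHagg 1 i (j - 1), site_mem_cluster ha hh1 hh2 (by omega), ?_⟩
    show z + _ + _ = z + p + _
    rw [add_assoc, add_assoc, e1, hcp_add_of_even a h Even.zero]
    congr 2 <;> ring
  have hnegp : -p ∈ A '' N := by
    rw [memA, add_neg_cancel_right, norm_neg]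
    exact ⟨by simpa using h0 ⟨0, ⟨⟨0, 0, 0, (barlowPos_alternating_zero a h).symm⟩,
      by simp; positivity⟩, rfl⟩, hpN.2⟩
  have himg : A '' N = halfTurn '' N := image_cluster_eq_twin ha hh hh1 hh2 A hX hnegp
  calc S ∩ Metric.ball (z + p) (13 / 10 * a) = (fun n => z + p + A n) '' N := hA
    _ = (fun n => z + p + n) '' (A '' N) := by rw [Set.image_image]
    _ = (fun n => z + p + n) '' (halfTurn '' N) := by rw [himg]

/-- **Interlayer step for clusters of type `g '' N`** (conjugate by the linear isometry `g`):
from the translates `z + g N`, `z + g u + g N`, `z + g v + g N` inside `S` to the cluster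
`g (halfTurn N)` at `z + g (w + h e₃)`. [folklore] -/
theorem interLayer_step_conj (ha : 0 < a) (hh : 0 < h) (hh1 : 64 / 100 * a ^ 2 < h ^ 2)
    (hh2 : h ^ 2 < 69 / 100 * a ^ 2) (g : EuclideanSpace ℝ (Fin 3) ≃ₗᵢ[ℝ] EuclideanSpace ℝ (Fin 3))
    {S : Set (EuclideanSpace ℝ (Fin 3))}
    (hS : ∀ y ∈ S, ∃ A : EuclideanSpace ℝ (Fin 3) ≃ₗᵢ[ℝ] EuclideanSpace ℝ (Fin 3),
      S ∩ Metric.ball y (13 / 10 * a) = (fun n => y + A n) ''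
        {p : EuclideanSpace ℝ (Fin 3) | p ∈ hcpStacking a h ∧ ‖p‖ < 13 / 10 * a})
    {z : EuclideanSpace ℝ (Fin 3)}
    (h0 : (fun n => z + n) '' (g '' {p : EuclideanSpace ℝ (Fin 3) | p ∈ hcpStacking a h ∧ ‖p‖ < 13 / 10 * a}) ⊆ S)
    (hu : (fun n => z + g (barlowPos a h alternatingHagg 0 1 0) + n) ''
      (g '' {p : EuclideanSpace ℝ (Fin 3) | p ∈ hcpStacking a h ∧ ‖p‖ < 13 / 10 * a}) ⊆ S)
    (hv : (fun n => z + g (barlowPos a h alternatingHagg 0 0 1) + n) ''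
      (g '' {p : EuclideanSpace ℝ (Fin 3) | p ∈ hcpStacking a h ∧ ‖p‖ < 13 / 10 * a}) ⊆ S) :
    S ∩ Metric.ball (z + g (barlowPos a h alternatingHagg 1 0 0)) (13 / 10 * a) =
      (fun n => z + g (barlowPos a h alternatingHagg 1 0 0) + n) ''
        (g '' (halfTurn '' {p : EuclideanSpace ℝ (Fin 3) | p ∈ hcpStacking a h ∧ ‖p‖ < 13 / 10 * a})) := by
  set N := {p : EuclideanSpace ℝ (Fin 3) | p ∈ hcpStacking a h ∧ ‖p‖ < 13 / 10 * a} with hN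
  set S' := g.symm '' S with hS'
  have hS'S : g '' S' = S := by rw [hS', ← Set.image_comp]; simp
  have hgg : ∀ M : Set (EuclideanSpace ℝ (Fin 3)), g.symm '' (g '' M) = M := fun M => by
    rw [← Set.image_comp]; simp
  have h1 : ∀ y ∈ S', ∃ A : EuclideanSpace ℝ (Fin 3) ≃ₗᵢ[ℝ] EuclideanSpace ℝ (Fin 3),
      S' ∩ Metric.ball y (13 / 10 * a) = (fun n => y + A n) '' N := localRule_transport g.symm hS
  have t0 := translate_subset_transport g.symm h0
  have tu := translate_subset_transport g.symm hu
  have tv := translate_subset_transport g.symm hv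
  rw [hgg] at t0 tu tv
  rw [map_add, g.symm_apply_apply] at tu tv
  have h3 := interLayer_step ha hh hh1 hh2 h1 t0 tu tv
  have h4 := cluster_transport g h3
  rw [hS'S, map_add, g.apply_symm_apply] at h4
  exact h4

end Propagation

end Summit.AtomisticToContinuum.Crystallization.Theorems.ExactHcpLocal

end
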